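import Literature.AlgebraicGeometry.HodgeTheory.GysinHodgeClassLift
import Literature.AlgebraicGeometry.HodgeTheory.GysinKernelWeights
import Literature.AlgebraicGeometry.HodgeTheory.ComplexGysinOrientation
import Literature.AlgebraicGeometry.HodgeTheory.ComplexGysinRational
import Literature.AlgebraicGeometry.Motives.HodgeStructureDirectSum
import Literature.AlgebraicGeometry.HodgeTheory.HodgeStructureOfHodgeModel
import Literature.AlgebraicGeometry.HodgeTheory.ComplexGysinHodgeType
import Literature.AlgebraicGeometry.HodgeTheory.HodgeFiltrationModelsReductionProofs
import Literature.AlgebraicGeometry.HodgeTheory.HodgeModelExistenceDischarge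
import HarnessLib

/-!
# Hodge classes lift along Gysin surjections: the named fact
# `Voisin2025_hodgeClass_lift_complexGysin` reduced to polarised Hodge structures on
# `Hᵏ(–(ℂ); ℚ)` for which the Gysin morphisms have bidegree `(e, e)`, and thence to de Rham's
# theorem, the Hodge decomposition and the polarisations

Companion to `GysinHodgeClassLift.lean` (the named fact
`Voisin2025_hodgeClass_lift_complexGysin`, D-0014: for `X` smooth projective of dimension `n` over
`ℂ`, a finite family `g j : Y j ⟶ X` from smooth projective `Y j` of dimensions `m j`, every
orientation family `μ` with Poincaré duality and every `q`, a RATIONAL class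
`c ∈ H^{2q}(X(ℂ); ℂ)` of Hodge type `(q, q)` lying in `Σⱼ im (g j)_*` lies in
`Σⱼ (g j)_* span_ℂ {rational classes of type (d, d) on Y j}`, `2d + 2n = 2q + 2 m j`) and to the
abstract form of its printed proof, PROVED in `Motives/HodgeStructureSemisimple` (C. Voisin,
*Hodge and generalized Hodge conjectures, coniveau and algebraic cycles*, J. Open Math. Probl. 1
(2025), Prop. 2.11: "The category of polarizable rational Hodge structures is semi-simple" and
Cor. 2.12: "Let `H, H′` be Hodge structures of weight `2k`, with `H′` polarized, and let
`φ : H′ → H` be a surjective morphism of Hodge structures. Then `φ : Hdg(H′) → Hdg(H)` is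
surjective") and `Motives/HodgeStructureDirectSum` (Cor. 2.12 for a finite family of morphisms
of bidegree `(eⱼ, eⱼ)` from polarised Hodge structures, with its complexified reading
`HodgeStructure.ofRat_mem_iSup_map_span_of_bidegree` — the use made of Cor. 2.12 in the proof
of Prop. 3.8, ibid. p. 28: "`j_* ⊗ Id = (j, Id)_*` is a morphism of polarized Hodge structures,
hence we can apply Corollary 2.12").

This file carries the printed proof to its end ON THE TREE'S CARRIERS: it proves the named fact
from the classical Hodge-theoretic inputs it quotes, taken as hypotheses stated on the rational
singular cohomology `Hᵏ(X(ℂ); ℚ) = singularCohomology ℚ ℚ (ComplexPoints X) k` of smooth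
projective complex varieties —

* `H`: a Hodge structure of weight `k` on each `Hᵏ(X(ℂ); ℚ)` (`Motives.HodgeStructure`, filtration
  form; the Hodge decomposition, Voisin, *Hodge Theory and Complex Algebraic Geometry I* (2002),
  §6.1.3 and §7.1.1), each polarisable (`hpol`; Lefschetz decomposition and Hodge–Riemann
  bilinear relations, ibid. Thm. 6.32 and §7.1.2 — "`H′ polarized`" in Cor. 2.12);
* `hHdg`: its Hodge classes `Hdgᵖ = H²ᵖ(X(ℂ); ℚ) ∩ Fᵖ` are exactly the rational classes whose
  image in `H²ᵖ(X(ℂ); ℂ)` is of Hodge type `(p, p)` in the tree's sense (`IsOfHodgeType`, through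
  a Hodge model; Deligne, *The Hodge conjecture* (2000), §1: "Hodge classes
  `= H²ᵖ(X, ℚ) ∩ H^{p,p}(X)`") — the compatibility clause (a) of
  `Motives.BettiHodgeData.IsSummitCompatible`, written with the change-of-coefficients map
  `ι = singularCohomology.ringChange (ℚ ↪ ℂ)` of `RationalClassesRingChange`;
* `hGys`: for every morphism `f : Y ⟶ X` of smooth projective varieties and every orientation
  family `μ` with Poincaré duality, the tree's Gysin morphism `complexGysin μ` (Fulton, *Young
  Tableaux*, App. B §B.1 (5): `f_* = PD⁻¹ ∘ f(ℂ)_* ∘ PD` on `H*(–(ℂ); ℂ)`) is, up to a non-zero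
  complex scalar `u` (the ratio of the chosen `ℂ`-orientations to the rational ones — `X(ℂ)`,
  `Y(ℂ)` are connected), the complexification of a `ℚ`-linear map `ψ : Hᵃ(Y(ℂ); ℚ) → Hᵇ(X(ℂ); ℚ)`
  of bidegree `(n − m, n − m)` for the Hodge filtrations: Voisin I, §7.3.2, "the Gysin morphism
  `φ_* : Hᵏ(X, ℤ) → H^{k+2r}(Y, ℤ)` is defined using Poincaré duality […] It is easy to see that
  `φ_*` is a morphism of Hodge structures of bidegree `(r, r)`"; Voisin 2025, §2.1 (p. 23):
  "`φ_*` […] is a morphism of Hodge structures (up to a shift of bidegrees by `(n, n)` that is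
  called a Tate twist)" —

none of which is vendored as a named fact here (D-0026): they are hypotheses of the theorems
below, to be supplied by the constructions of the Hodge decomposition, the polarisations and the
rational Gysin morphisms on the tree's carriers (named facts `nonempty_hodgeModel`,
`hodgePQ_independent_of_hodgeModel`, `Motives.hasHardLefschetzProperty_kaehlerClass`, …). Given
them, the proof is the printed one: write `c = ι(x)` (`IsRationalClass.exists_ringChange_eq`);
`x` is a Hodge class of `H^{2q}(X(ℂ); ℚ)` (`hHdg`); the complexification
`β_X : H^{2q}(X(ℂ); ℚ) ⊗ ℂ → H^{2q}(X(ℂ); ℂ)` of `ι` is injective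
(`injective_liftBaseChange_ringChange`, Voisin I §7.1.1) and `β_{Y j}` is onto (the rational
classes span, `span_isRationalClass_eq_top_of_isSmoothProjective_holds`), so that
`im (g j)_* = β_X (im (ψ j)_ℂ)` and `x ⊗ 1 ∈ Σⱼ im (ψ j)_ℂ`; Cor. 2.12 for the family `(ψ j)`
(`HodgeStructure.ofRat_mem_iSup_map_span_of_bidegree`: the `ψ j` are morphisms
`H^{2d}(Y j)(−e j) → H^{2q}(X)` from Tate twists of polarised structures) gives
`x ⊗ 1 ∈ Σⱼ (ψ j)_ℂ span_ℂ {y ⊗ 1 | y ∈ Hdg^{d}(H^{2d}(Y j(ℂ); ℚ))}`; applying `β_X` and `hHdg`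
for the `Y j` (`ι(y)` is rational of type `(d, d)`) yields the conclusion, the scalars `u` being
absorbed by the `ℂ`-spans.

Main results: `Voisin2025_hodgeClass_lift_complexGysin.of_hodgeStructures` (one `X`, one family,
one `q`: the data are only needed in the degrees at hand) and
`Voisin2025_hodgeClass_lift_complexGysin_of_hodgeStructures` (the named fact from global data).
Since the Gysin morphisms `complexGysin μ` depend on the orientation family `μ` only up to
non-zero scalars (`ComplexGysinOrientation`: `X(ℂ)` is connected), the named fact holds for every
`μ` with Poincaré duality as soon as its body holds for ONE such family
(`Voisin2025_hodgeClass_lift_complexGysin_of_orientationFamily`), and accordingly the Gysin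
hypothesis `hGys` need only be supplied for one family
(`Voisin2025_hodgeClass_lift_complexGysin_of_hodgeStructures_of_orientationFamily`).
Finally, since `complexGysin μ` restricted to rational classes IS the rational Gysin homomorphism
`gysinMap ν_Y ν_X f(ℂ)` of the tree up to a non-zero scalar, for any `ℚ`-orientations with
Poincaré duality (`ComplexGysinRational.complexGysin_ringChange_eq_smul_gysinMap`), the Gysin
hypothesis reduces to its Hodge-theoretic core, the BIDEGREE `(dim X − dim Y, dim X − dim Y)` of
the rational Gysin homomorphisms for the Hodge filtrations (Voisin I §7.3.2 verbatim):
`Voisin2025_hodgeClass_lift_complexGysin_of_hodgeStructures_of_rationalGysin`.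
Everything so far is relative to abstract data `H`. The last section INSTANTIATES the data with
the tree's constructions: `H` is the Hodge structure `HodgeModel.hodgeStructure` of a Hodge
symmetric (e.g. real) Hodge model (`HodgeStructureOfHodgeModel`; real models exist by the named
fact `exists_isReal_hodgeModel`, itself reduced in `HodgeModelExistenceDischarge` to de Rham's
theorem `exists_deRhamIsoFamily` and the Hodge decomposition of compact Kähler manifolds
`Motives.isInternal_hodgePQ`); `hHdg` is `HodgeModel.mem_hodgeClasses_iff_isOfHodgeType_ringChange`
(through `hodgePQ_independent_of_hodgeModel`, now the theorem
`hodgePQ_independent_of_hodgeModel_holds`); and the bidegree of the Gysin morphisms for the Hodge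
FILTRATIONS (`HodgeModel.map_baseChange_hodgeStructure_F_le`) follows from their bidegree on Hodge
TYPES (`isOfHodgeType_complexGysin_of_cupPreservesHodgeType`, Voisin I §7.3.2 with Lemma 7.30, file
`ComplexGysinHodgeType`; cup products add types by de Rham's theorem in multiplicative form,
`cupPreservesHodgeType_of_nonempty_hodgeModel`) together with the vanishing of `f_*` on the types
it cannot shift (`complexGysin_eq_zero_of_hodgeType_of_lt`: there are no Hodge types beyond the
dimension, `HodgeModel.eq_zero_of_mem_hodgePQ_of_lt`). Hence
`Voisin2025_hodgeClass_lift_complexGysin_of_exists_isReal_hodgeModel` and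
`Voisin2025_hodgeClass_lift_complexGysin_of_deRham_of_hodgeDecomposition`: **the named fact follows
from de Rham's theorem (`exists_deRhamIsoFamily`), the Hodge decomposition (`isInternal_hodgePQ`)
and the polarisability of the Hodge structures of Hodge symmetric models of smooth projective
varieties** (`hpol`, in the binder shape of `HodgeConjectureQbarVoisinProofs`: hard Lefschetz,
Lefschetz decomposition and the Hodge–Riemann relations on these carriers, Voisin I Thm. 6.32 —
not yet in the tree). Everything in this file is a theorem; the named fact itself is NOT
discharged — what remains is exactly those two named facts and `hpol`.

## References

* [Voisin2025] C. Voisin, Hodge and generalized Hodge conjectures, coniveau and algebraic cycles,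
  J. Open Math. Probl. 1 (2025) 16–51, §2.1, Prop. 2.11, Cor. 2.12, proof of Prop. 3.8.
* [VoisinHodgeI2002] C. Voisin, Hodge Theory and Complex Algebraic Geometry I, CUP 2002, §6.1.3,
  Thm. 6.32, §7.1.1, §7.1.2, Lemma 7.26, §7.3.2.
* [Deligne2000] P. Deligne, The Hodge conjecture, Clay Mathematics Institute (2000), §1.
* [FultonYoungTableaux1997] W. Fulton, Young Tableaux, CUP 1997, App. B §B.1 (5).
* [Jannsen1990MixedMotives] U. Jannsen, Mixed Motives and Algebraic K-Theory, LNM 1400, §7,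
  7.8–7.9.
* [HatcherAT2002] A. Hatcher, Algebraic Topology, CUP 2002, §3.1 p. 198 (change of coefficients),
  §3.3 Thm. 3.30, Prop. 3.38.
* [SerreGAGA1956] J.-P. Serre, Géométrie algébrique et géométrie analytique, Ann. Inst. Fourier 6
  (1956), §2.
-/

noncomputable section

open CategoryTheory AlgebraicGeometry
open scoped TensorProduct
open Literature.AlgebraicTopology.SingularHomology

namespace Literature.AlgebraicGeometry.HodgeTheory

section HodgeTheory

/-! ### Linear algebra: a complex map which is a scalar multiple of a complexified rational map -/

section LinearAlgebra

open Literature.AlgebraicGeometry.Motives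

universe u v u' v'

variable {V : Type u} [AddCommGroup V] [Module ℚ V] {W : Type v} [AddCommGroup W] [Module ℚ W]
  {V' : Type u'} [AddCommGroup V'] [Module ℂ V'] [Module ℚ V'] [IsScalarTower ℚ ℂ V']
  {W' : Type v'} [AddCommGroup W'] [Module ℂ W'] [Module ℚ W'] [IsScalarTower ℚ ℂ W']

/-- The complexification `V ⊗ ℂ → V'` of a `ℚ`-linear map `i : V → V'` into a complex vector space
sends `v ⊗ 1` to `i v`. [folklore] -/
theorem liftBaseChange_ofRat (iV : V →ₗ[ℚ] V') (v : V) :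
    iV.liftBaseChange ℂ (HodgeStructure.ofRat v) = iV v := by
  rw [HodgeStructure.ofRat_apply, LinearMap.liftBaseChange_tmul, one_smul]

/-- **A complex map which is `u` times a rational map on rational vectors is `u` times its
complexification**: for `ℚ`-linear `i_V : V → V'`, `i_W : W → W'` into complex vector spaces, a
`ℂ`-linear `G : W' → V'`, a `ℚ`-linear `ψ : W → V` and `u ∈ ℂ` with `G (i_W w) = u • i_V (ψ w)`
for all `w`, one has `G ∘ (i_W)_ℂ = u • (i_V)_ℂ ∘ ψ_ℂ` on `W ⊗ ℂ` (check on pure tensors).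
[folklore] -/
theorem apply_liftBaseChange_eq_smul (iV : V →ₗ[ℚ] V') (iW : W →ₗ[ℚ] W') (G : W' →ₗ[ℂ] V')
    (ψ : W →ₗ[ℚ] V) (u : ℂ) (h : ∀ w, G (iW w) = u • iV (ψ w)) (t : ℂ ⊗[ℚ] W) :
    G (iW.liftBaseChange ℂ t) = u • iV.liftBaseChange ℂ (ψ.baseChange ℂ t) := by
  induction t using TensorProduct.induction_on with
  | zero => simp only [map_zero, smul_zero]
  | tmul a w =>
    rw [LinearMap.liftBaseChange_tmul, LinearMap.baseChange_tmul, LinearMap.liftBaseChange_tmul,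
      map_smul, h, smul_comm]
  | add s t hs ht => simp only [map_add, smul_add, hs, ht]

/-- With the data of `apply_liftBaseChange_eq_smul` and `(i_W)_ℂ` onto (the rational vectors span
`W'`), the image of `G` lies in the image under `(i_V)_ℂ` of the image of `ψ_ℂ`:
`im G = u • (i_V)_ℂ (im ψ_ℂ)`. [folklore] -/
theorem range_le_map_liftBaseChange_range (iV : V →ₗ[ℚ] V') (iW : W →ₗ[ℚ] W') (G : W' →ₗ[ℂ] V')
    (ψ : W →ₗ[ℚ] V) (u : ℂ) (h : ∀ w, G (iW w) = u • iV (ψ w))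
    (hW : LinearMap.range (iW.liftBaseChange ℂ) = ⊤) :
    LinearMap.range G ≤ (LinearMap.range (ψ.baseChange ℂ)).map (iV.liftBaseChange ℂ) := by
  rintro _ ⟨y', rfl⟩
  obtain ⟨t, rfl⟩ : y' ∈ LinearMap.range (iW.liftBaseChange ℂ) := hW ▸ Submodule.mem_top
  refine ⟨ψ.baseChange ℂ (u • t), ⟨u • t, rfl⟩, ?_⟩
  rw [apply_liftBaseChange_eq_smul iV iW G ψ u h, map_smul, map_smul]

/-- With the data of `apply_liftBaseChange_eq_smul` and `u ≠ 0`, for every `S ⊆ W` the image under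
`(i_V)_ℂ ∘ ψ_ℂ` of the `ℂ`-span of `{s ⊗ 1 | s ∈ S}` lies in the image under `G` of the `ℂ`-span
of `i_W(S)` (`(i_V)_ℂ ∘ ψ_ℂ = u⁻¹ • G ∘ (i_W)_ℂ` and `(i_W)_ℂ (s ⊗ 1) = i_W s`). [folklore] -/
theorem map_liftBaseChange_map_span_le (iV : V →ₗ[ℚ] V') (iW : W →ₗ[ℚ] W') (G : W' →ₗ[ℂ] V')
    (ψ : W →ₗ[ℚ] V) (u : ℂ) (h : ∀ w, G (iW w) = u • iV (ψ w)) (hu : u ≠ 0) (S : Set W) :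
    ((Submodule.span ℂ (HodgeStructure.ofRat '' S)).map (ψ.baseChange ℂ)).map
        (iV.liftBaseChange ℂ) ≤
      (Submodule.span ℂ (iW '' S)).map G := by
  rintro _ ⟨_, ⟨s, hs, rfl⟩, rfl⟩
  refine ⟨iW.liftBaseChange ℂ (u⁻¹ • s), ?_, ?_⟩
  · rw [map_smul]
    refine Submodule.smul_mem _ _ ?_
    have hle : Submodule.span ℂ (HodgeStructure.ofRat '' S) ≤
        (Submodule.span ℂ (iW '' S)).comap (iW.liftBaseChange ℂ) := by
      rw [Submodule.span_le]
      rintro _ ⟨w, hw, rfl⟩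
      rw [SetLike.mem_coe, Submodule.mem_comap, liftBaseChange_ofRat]
      exact Submodule.subset_span ⟨w, hw, rfl⟩
    exact hle hs
  · rw [apply_liftBaseChange_eq_smul iV iW G ψ u h, map_smul, map_smul, smul_smul,
      mul_inv_cancel₀ hu, one_smul]

end LinearAlgebra

/-! ### The rational structure of `Hᵏ(X(ℂ); ℂ)` for `X` smooth projective is onto -/

section Cohomology

variable {n : ℕ} {X : Motives.SchemeOver ℂ}

/-- **`Hᵏ(X(ℂ); ℚ) ⊗_ℚ ℂ → Hᵏ(X(ℂ); ℂ)` is onto for `X` smooth projective** (the complexification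
of `ι = ringChange (ℚ ↪ ℂ)`, for any `ℚ`-module structure on `Hᵏ(X(ℂ); ℂ)` compatible with the
complex one): its image is the `ℂ`-span of the rational classes, which is everything (the tree's
`span_isRationalClass_eq_top_of_isSmoothProjective_holds`, Voisin I §7.1.1:
"`Hᵏ(X, ℤ) ⊗ R ≅ Hᵏ(X, R)`"). With `injective_liftBaseChange_ringChange` this is the
identification `Hᵏ(X(ℂ); ℚ) ⊗ ℂ = Hᵏ(X(ℂ); ℂ)`. [cite: VoisinHodgeI2002, §7.1.1] -/
theorem range_liftBaseChange_ringChange_eq_top (hX : Motives.IsSmoothProjective n X) (k : ℕ)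
    [Module ℚ (singularCohomology ℂ ℂ (Motives.ComplexPoints X) k)]
    [IsScalarTower ℚ ℂ (singularCohomology ℂ ℂ (Motives.ComplexPoints X) k)] :
    LinearMap.range ((singularCohomology.ringChange (algebraMap ℚ ℂ) (Motives.ComplexPoints X)
      k).toRatLinearMap.liftBaseChange ℂ) = ⊤ := by
  rw [LinearMap.range_liftBaseChange, LinearMap.coe_range]
  have h := span_isRationalClass_eq_top_of_isSmoothProjective_holds n X hX k
  rw [setOf_isRationalClass_eq_range] at h
  have e : Set.range ((singularCohomology.ringChange (algebraMap ℚ ℂ) (Motives.ComplexPoints X)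
      k).toRatLinearMap) =
      Set.range (singularCohomology.ringChange (algebraMap ℚ ℂ) (Motives.ComplexPoints X) k) := rfl
  rw [e, h]

end Cohomology

/-! ### The reduction -/

section Reduction

open Literature.AlgebraicGeometry.Motives

variable {n : ℕ} {X : Motives.SchemeOver ℂ}

/-- **Voisin 2025, Cor. 2.12 applied to a family of Gysin morphisms, on the tree's carriers —
local form.** Let `X` be smooth projective of dimension `n`, `g j : Y j ⟶ X` a finite family from
smooth projective `Y j` of dimensions `m j`, `μ` an orientation family and `q : ℕ`. Suppose given:
a Hodge structure `HX` of weight `2q` on `H^{2q}(X(ℂ); ℚ)` whose Hodge classes contain the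
rational classes of type `(q, q)` (`hHX`); for every `j` and every `d` with `2d + 2n = 2q + 2 m j`
a polarisable Hodge structure `HY j d` of weight `2d` on `H^{2d}(Y j(ℂ); ℚ)` whose Hodge classes
are of type `(d, d)` (`hpol`, `hHY`; "`H′ polarized`"); and, for each such `(j, d)`, a
`ℚ`-linear `ψ : H^{2d}(Y j(ℂ); ℚ) → H^{2q}(X(ℂ); ℚ)` of bidegree `(n − m j, n − m j)` for the
Hodge filtrations and a scalar `u ≠ 0` with `(g j)_* (ι y) = u • ι (ψ y)` (`hG`: the Gysin
morphism is a morphism of Hodge structures of bidegree `(r, r)`, Voisin I §7.3.2, defined over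
`ℚ` up to the orientation scalar). THEN every rational class `c ∈ H^{2q}(X(ℂ); ℂ)` of type `(q, q)`
lying in `Σⱼ im (g j)_*` lies in `Σⱼ (g j)_* span_ℂ {rational classes of type (d, d) on Y j}` —
the conclusion of `Voisin2025_hodgeClass_lift_complexGysin`. Proof: module docstring (Cor. 2.12
for the family `ψ`, `HodgeStructure.ofRat_mem_iSup_map_span_of_bidegree`, transported along the
injective, resp. surjective, complexifications of `ι_X`, resp. `ι_{Y j}`).
[cite: Voisin2025, Cor. 2.12, Prop. 2.11 and proof of Prop. 3.8] [cite: VoisinHodgeI2002, §7.1.1, Lemma 7.26 and §7.3.2]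
[cite: Jannsen1990MixedMotives, §7, 7.8 and Thm. 7.9] -/
theorem Voisin2025_hodgeClass_lift_complexGysin.of_hodgeStructures (μ : OrientationFamily)
    (hX : IsSmoothProjective n X) {ι : Type} [Finite ι] {m : ι → ℕ}
    {Y : ι → Motives.SchemeOver ℂ} (hY : ∀ j, IsSmoothProjective (m j) (Y j))
    (g : ∀ j, Y j ⟶ X) (q : ℕ)
    (HX : HodgeStructure (singularCohomology ℚ ℚ (ComplexPoints X) (2 * q)) ((2 * q : ℕ) : ℤ))
    (HY : ∀ (j : ι) (d : ℕ), 2 * d + 2 * n = 2 * q + 2 * m j →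
      HodgeStructure (singularCohomology ℚ ℚ (ComplexPoints (Y j)) (2 * d)) ((2 * d : ℕ) : ℤ))
    (hpol : ∀ j d hd, (HY j d hd).IsPolarizable)
    (hHX : ∀ x : singularCohomology ℚ ℚ (ComplexPoints X) (2 * q),
      IsOfHodgeType n X (2 * q) q q
          (singularCohomology.ringChange (algebraMap ℚ ℂ) (ComplexPoints X) (2 * q) x) →
        x ∈ HX.hodgeClasses q)
    (hHY : ∀ j d hd (y : singularCohomology ℚ ℚ (ComplexPoints (Y j)) (2 * d)),
      y ∈ (HY j d hd).hodgeClasses d →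
        IsOfHodgeType (m j) (Y j) (2 * d) d d
          (singularCohomology.ringChange (algebraMap ℚ ℂ) (ComplexPoints (Y j)) (2 * d) y))
    (hG : ∀ j d hd, ∃ (u : ℂ) (ψ : singularCohomology ℚ ℚ (ComplexPoints (Y j)) (2 * d) →ₗ[ℚ]
        singularCohomology ℚ ℚ (ComplexPoints X) (2 * q)),
      u ≠ 0 ∧ (∀ p : ℤ, ((HY j d hd).F p).map (ψ.baseChange ℂ) ≤ HX.F (p + ((n : ℤ) - m j))) ∧
        ∀ y, complexGysin μ (hY j) hX (g j) hd
            (singularCohomology.ringChange (algebraMap ℚ ℂ) (ComplexPoints (Y j)) (2 * d) y) =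
          u • singularCohomology.ringChange (algebraMap ℚ ℂ) (ComplexPoints X) (2 * q) (ψ y))
    {c : complexBetti X (2 * q)} (hc : IsRationalClass c) (hc' : IsOfHodgeType n X (2 * q) q q c)
    (hcg : c ∈ ⨆ (j : ι) (a : ℕ) (hab : a + 2 * n = 2 * q + 2 * m j),
      LinearMap.range (complexGysin μ (hY j) hX (g j) hab)) :
    c ∈ ⨆ (j : ι) (d : ℕ) (hd : 2 * d + 2 * n = 2 * q + 2 * m j),
      (Submodule.span ℂ {b : complexBetti (Y j) (2 * d) |
          IsRationalClass b ∧ IsOfHodgeType (m j) (Y j) (2 * d) d d b}).map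
        (complexGysin μ (hY j) hX (g j) hd) := by
  classical
  -- rational structures on the complex carriers (`q • x := (q : ℂ) • x`)
  letI mX : Module ℚ (complexBetti X (2 * q)) := Module.compHom _ (algebraMap ℚ ℂ)
  haveI tX : IsScalarTower ℚ ℂ (complexBetti X (2 * q)) := ⟨fun a b x ↦ by
    change (a • b) • x = algebraMap ℚ ℂ a • (b • x)
    rw [Algebra.smul_def, mul_smul]⟩
  letI mY : ∀ j k, Module ℚ (complexBetti (Y j) k) := fun j k ↦ Module.compHom _ (algebraMap ℚ ℂ)
  haveI tY : ∀ j k, IsScalarTower ℚ ℂ (complexBetti (Y j) k) := fun j k ↦ ⟨fun a b x ↦ by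
    change (a • b) • x = algebraMap ℚ ℂ a • (b • x)
    rw [Algebra.smul_def, mul_smul]⟩
  -- the index family `(j, d)`, `2d + 2n = 2q + 2 m j`, is finite
  haveI hsub : ∀ j, Subsingleton {d : ℕ // 2 * d + 2 * n = 2 * q + 2 * m j} := fun j ↦
    ⟨fun a b ↦ Subtype.ext (by have := a.2; have := b.2; omega)⟩
  haveI hfinY : ∀ i : (Σ j : ι, {d : ℕ // 2 * d + 2 * n = 2 * q + 2 * m j}),
      Module.Finite ℚ (singularCohomology ℚ ℚ (ComplexPoints (Y i.1)) (2 * i.2.1)) :=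
    fun i ↦ finite_singularCohomology_rat_complexPoints (hY i.1) _
  choose u ψ hu hψF hψG using hG
  -- `c = ι x` with `x` a Hodge class of `HX`
  obtain ⟨x, rfl⟩ := hc.exists_ringChange_eq
  have hx : x ∈ HX.hodgeClasses q := hHX x hc'
  have hinjX : Function.Injective ((singularCohomology.ringChange (algebraMap ℚ ℂ)
      (ComplexPoints X) (2 * q)).toRatLinearMap.liftBaseChange ℂ) :=
    injective_liftBaseChange_ringChange (ComplexPoints X) (2 * q)
  have hcx : (singularCohomology.ringChange (algebraMap ℚ ℂ) (ComplexPoints X)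
      (2 * q)).toRatLinearMap.liftBaseChange ℂ (HodgeStructure.ofRat x) =
      singularCohomology.ringChange (algebraMap ℚ ℂ) (ComplexPoints X) (2 * q) x :=
    liftBaseChange_ofRat _ x
  -- `x ⊗ 1 ∈ Σ_{(j,d)} im (ψ j d)_ℂ`
  have h5 : HodgeStructure.ofRat x ∈
      ⨆ i : (Σ j : ι, {d : ℕ // 2 * d + 2 * n = 2 * q + 2 * m j}),
        LinearMap.range ((ψ i.1 i.2.1 i.2.2).baseChange ℂ) := by
    have hle : (⨆ (j : ι) (a : ℕ) (hab : a + 2 * n = 2 * q + 2 * m j),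
        LinearMap.range (complexGysin μ (hY j) hX (g j) hab)) ≤
        (⨆ i : (Σ j : ι, {d : ℕ // 2 * d + 2 * n = 2 * q + 2 * m j}),
          LinearMap.range ((ψ i.1 i.2.1 i.2.2).baseChange ℂ)).map
          ((singularCohomology.ringChange (algebraMap ℚ ℂ) (ComplexPoints X)
            (2 * q)).toRatLinearMap.liftBaseChange ℂ) := by
      refine iSup_le fun j ↦ iSup_le fun a ↦ iSup_le fun hab ↦ ?_
      obtain ⟨d, rfl⟩ : ∃ d, a = 2 * d := ⟨a / 2, by omega⟩
      refine (range_le_map_liftBaseChange_range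
        (singularCohomology.ringChange (algebraMap ℚ ℂ) (ComplexPoints X) (2 * q)).toRatLinearMap
        (singularCohomology.ringChange (algebraMap ℚ ℂ) (ComplexPoints (Y j)) (2 * d)).toRatLinearMap
        (complexGysin μ (hY j) hX (g j) hab) (ψ j d hab) (u j d hab) (fun y ↦ hψG j d hab y)
        (range_liftBaseChange_ringChange_eq_top (hY j) (2 * d))).trans (Submodule.map_mono ?_)
      exact le_iSup (fun i : (Σ j : ι, {d : ℕ // 2 * d + 2 * n = 2 * q + 2 * m j}) ↦
        LinearMap.range ((ψ i.1 i.2.1 i.2.2).baseChange ℂ)) ⟨j, d, hab⟩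
    obtain ⟨t, ht, hteq⟩ := hle hcg
    rw [← hcx] at hteq
    rw [← hinjX hteq]
    exact ht
  -- Cor. 2.12 for the family `ψ` (Tate twists of the polarised `HY j d`)
  have h6 := HodgeStructure.ofRat_mem_iSup_map_span_of_bidegree
    (H' := fun i : (Σ j : ι, {d : ℕ // 2 * d + 2 * n = 2 * q + 2 * m j}) ↦ HY i.1 i.2.1 i.2.2)
    (H := HX) (fun i ↦ hpol i.1 i.2.1 i.2.2) (fun i ↦ ((n : ℤ) - m i.1))
    (fun i ↦ by have := i.2.2; push_cast; omega) (fun i ↦ ψ i.1 i.2.1 i.2.2)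
    (fun i p ↦ hψF i.1 i.2.1 i.2.2 p) (k := (q : ℤ)) (by push_cast; ring) hx h5
  -- apply `β_X` and read the result on the tree's carriers
  have h7 := Submodule.mem_map_of_mem
    (f := (singularCohomology.ringChange (algebraMap ℚ ℂ) (ComplexPoints X)
      (2 * q)).toRatLinearMap.liftBaseChange ℂ) h6
  rw [hcx, Submodule.map_iSup] at h7
  refine SetLike.le_def.1 (iSup_le fun i ↦ ?_) h7
  obtain ⟨j, d, hd⟩ := i
  refine le_trans ?_ (le_iSup_of_le j (le_iSup_of_le d (le_iSup_of_le hd le_rfl)))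
  refine (map_liftBaseChange_map_span_le
    (singularCohomology.ringChange (algebraMap ℚ ℂ) (ComplexPoints X) (2 * q)).toRatLinearMap
    (singularCohomology.ringChange (algebraMap ℚ ℂ) (ComplexPoints (Y j)) (2 * d)).toRatLinearMap
    (complexGysin μ (hY j) hX (g j) hd) (ψ j d hd) (u j d hd) (fun y ↦ hψG j d hd y) (hu j d hd)
    _).trans (Submodule.map_mono (Submodule.span_mono ?_))
  rintro _ ⟨y, hy, rfl⟩
  have e : (q : ℤ) - ((n : ℤ) - m j) = d := by omega
  have hy' : y ∈ (HY j d hd).hodgeClasses d := by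
    rw [← e]
    exact hy
  exact ⟨isRationalClass_ringChange y, hHY j d hd y hy'⟩

/-- **`Voisin2025_hodgeClass_lift_complexGysin` from polarised Hodge structures on the rational
cohomology of smooth projective varieties for which the Gysin morphisms have bidegree `(e, e)`.**
Let `H` assign to every smooth projective `X` of dimension `n` over `ℂ` and every `k` a Hodge
structure of weight `k` on `Hᵏ(X(ℂ); ℚ)` (Hodge decomposition, Voisin I §6.1.3, §7.1.1) such
that: every `H_X^k` is polarisable (`hpol`; Lefschetz decomposition and Hodge–Riemann relations,
Voisin I Thm. 6.32, §7.1.2); its Hodge classes `Hdgᵖ(H_X^{2p})` are exactly the `x` whose image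
`ι(x) ∈ H²ᵖ(X(ℂ); ℂ)` is of Hodge type `(p, p)` (`hHdg`; Deligne 2000, §1); and for every
morphism `f : Y ⟶ X` of smooth projective varieties, every orientation family `μ` with Poincaré
duality and all degrees `a + 2 dim X = b + 2 dim Y`, the Gysin morphism
`complexGysin μ … f : Hᵃ(Y(ℂ); ℂ) → Hᵇ(X(ℂ); ℂ)` equals `u • ψ_ℂ` on rational classes for some
`u ≠ 0` and some `ℚ`-linear `ψ : Hᵃ(Y(ℂ); ℚ) → Hᵇ(X(ℂ); ℚ)` of bidegree
`(dim X − dim Y, dim X − dim Y)` for the Hodge filtrations (`hGys`; Voisin I §7.3.2: "`φ_*` is a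
morphism of Hodge structures of bidegree `(r, r)`"; Fulton, App. B §B.1 (5)). THEN the named fact
`Voisin2025_hodgeClass_lift_complexGysin` holds (Voisin 2025, Cor. 2.12 applied as in the proof
of Prop. 3.8; `Voisin2025_hodgeClass_lift_complexGysin.of_hodgeStructures`). What this leaves of
the discharge is exactly the three inputs `H`/`hpol`, `hHdg`, `hGys` on the tree's carriers.
[cite: Voisin2025, Cor. 2.12, Prop. 2.11, §2.1 and proof of Prop. 3.8]
[cite: VoisinHodgeI2002, §7.1.1, §7.1.2, Lemma 7.26 and §7.3.2] [cite: Deligne2000, §1]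
[cite: Jannsen1990MixedMotives, §7, 7.8 and Thm. 7.9] -/
theorem Voisin2025_hodgeClass_lift_complexGysin_of_hodgeStructures
    (H : ∀ ⦃n : ℕ⦄ ⦃X : Motives.SchemeOver ℂ⦄, IsSmoothProjective n X → ∀ k : ℕ,
      HodgeStructure (singularCohomology ℚ ℚ (ComplexPoints X) k) (k : ℤ))
    (hpol : ∀ ⦃n : ℕ⦄ ⦃X : Motives.SchemeOver ℂ⦄ (hX : IsSmoothProjective n X) (k : ℕ),
      (H hX k).IsPolarizable)
    (hHdg : ∀ ⦃n : ℕ⦄ ⦃X : Motives.SchemeOver ℂ⦄ (hX : IsSmoothProjective n X) (p : ℕ)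
      (x : singularCohomology ℚ ℚ (ComplexPoints X) (2 * p)),
      x ∈ (H hX (2 * p)).hodgeClasses p ↔
        IsOfHodgeType n X (2 * p) p p
          (singularCohomology.ringChange (algebraMap ℚ ℂ) (ComplexPoints X) (2 * p) x))
    (hGys : ∀ (μ : OrientationFamily), μ.HasPoincareDuality →
      ∀ ⦃m n : ℕ⦄ ⦃Y X : Motives.SchemeOver ℂ⦄ (hY : IsSmoothProjective m Y)
        (hX : IsSmoothProjective n X) (f : Y ⟶ X) ⦃a b : ℕ⦄ (hab : a + 2 * n = b + 2 * m),
        ∃ (u : ℂ) (ψ : singularCohomology ℚ ℚ (ComplexPoints Y) a →ₗ[ℚ]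
            singularCohomology ℚ ℚ (ComplexPoints X) b),
          u ≠ 0 ∧ (∀ p : ℤ, ((H hY a).F p).map (ψ.baseChange ℂ) ≤ (H hX b).F (p + ((n : ℤ) - m))) ∧
            ∀ y, complexGysin μ hY hX f hab
                (singularCohomology.ringChange (algebraMap ℚ ℂ) (ComplexPoints Y) a y) =
              u • singularCohomology.ringChange (algebraMap ℚ ℂ) (ComplexPoints X) b (ψ y)) :
    Voisin2025_hodgeClass_lift_complexGysin := by
  intro μ hμ n X hX ι _ m Y hY g q c hc hc' hcg
  exact Voisin2025_hodgeClass_lift_complexGysin.of_hodgeStructures μ hX hY g q (H hX (2 * q))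
    (fun j d _ ↦ H (hY j) (2 * d)) (fun j d _ ↦ hpol (hY j) (2 * d))
    (fun x hx ↦ (hHdg hX q x).2 hx) (fun j d _ y hy ↦ (hHdg (hY j) d y).1 hy)
    (fun j d hd ↦ hGys μ hμ (hY j) hX (g j) hd) hc hc' hcg

/-! ### One orientation family suffices -/

/-- **`Voisin2025_hodgeClass_lift_complexGysin` holds for every orientation family with Poincaré
duality as soon as its body holds for one.** The hypothesis and the conclusion of the named fact
only involve the images `im (g j)_*` and the images `(g j)_* S` of `ℂ`-subspaces `S`, which do not
depend on the orientation family (`range_complexGysin_eq_of_orientationFamily`,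
`map_complexGysin_eq_of_orientationFamily`: two `ℂ`-orientations of the connected closed manifold
`X(ℂ)` have proportional fundamental classes, Hatcher Thm. 3.26, so the Gysin morphisms differ by
non-zero scalars). [cite: Voisin2025, Cor. 2.12 and proof of Prop. 3.8]
[cite: FultonYoungTableaux1997, Appendix B §B.1 (5)] [cite: HatcherAT2002, §3.3 Thm. 3.26] -/
theorem Voisin2025_hodgeClass_lift_complexGysin_of_orientationFamily (μ₀ : OrientationFamily)
    (hμ₀ : μ₀.HasPoincareDuality)
    (h : ∀ ⦃n : ℕ⦄ ⦃X : Motives.SchemeOver ℂ⦄ (hX : IsSmoothProjective n X) ⦃ι : Type⦄ [Finite ι]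
      ⦃m : ι → ℕ⦄ ⦃Y : ι → Motives.SchemeOver ℂ⦄ (hY : ∀ j, IsSmoothProjective (m j) (Y j))
      (g : ∀ j, Y j ⟶ X) (q : ℕ) ⦃c : complexBetti X (2 * q)⦄, IsRationalClass c →
      IsOfHodgeType n X (2 * q) q q c →
      c ∈ ⨆ (j : ι) (a : ℕ) (hab : a + 2 * n = 2 * q + 2 * m j),
          LinearMap.range (complexGysin μ₀ (hY j) hX (g j) hab) →
      c ∈ ⨆ (j : ι) (d : ℕ) (hd : 2 * d + 2 * n = 2 * q + 2 * m j),
          (Submodule.span ℂ {b : complexBetti (Y j) (2 * d) |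
              IsRationalClass b ∧ IsOfHodgeType (m j) (Y j) (2 * d) d d b}).map
            (complexGysin μ₀ (hY j) hX (g j) hd)) :
    Voisin2025_hodgeClass_lift_complexGysin := by
  intro μ hμ n X hX ι _ m Y hY g q c hc hc' hcg
  simp_rw [range_complexGysin_eq_of_orientationFamily hμ₀ hμ] at hcg
  simp_rw [map_complexGysin_eq_of_orientationFamily hμ₀ hμ]
  exact h hX hY g q hc hc' hcg

/-- **`Voisin2025_hodgeClass_lift_complexGysin` from polarised Hodge structures on the rational
cohomology and the bidegree of the Gysin morphisms of ONE orientation family.** As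
`Voisin2025_hodgeClass_lift_complexGysin_of_hodgeStructures`, but with the Gysin hypothesis
`hGys₀` required only for a single orientation family `μ₀` with Poincaré duality (e.g. the
complexification of a family of rational orientations, for which `u = 1` and `ψ` is the rational
Gysin morphism of Voisin I §7.3.2): `complexGysin μ₀ … f (ι y) = u • ι (ψ y)` with `u ≠ 0` and
`ψ : Hᵃ(Y(ℂ); ℚ) → Hᵇ(X(ℂ); ℚ)` of bidegree `(dim X − dim Y, dim X − dim Y)` for the Hodge
filtrations. [cite: Voisin2025, Cor. 2.12, Prop. 2.11, §2.1 and proof of Prop. 3.8]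
[cite: VoisinHodgeI2002, §7.1.1, §7.1.2, Lemma 7.26 and §7.3.2] [cite: Deligne2000, §1] -/
theorem Voisin2025_hodgeClass_lift_complexGysin_of_hodgeStructures_of_orientationFamily
    (μ₀ : OrientationFamily) (hμ₀ : μ₀.HasPoincareDuality)
    (H : ∀ ⦃n : ℕ⦄ ⦃X : Motives.SchemeOver ℂ⦄, IsSmoothProjective n X → ∀ k : ℕ,
      HodgeStructure (singularCohomology ℚ ℚ (ComplexPoints X) k) (k : ℤ))
    (hpol : ∀ ⦃n : ℕ⦄ ⦃X : Motives.SchemeOver ℂ⦄ (hX : IsSmoothProjective n X) (k : ℕ),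
      (H hX k).IsPolarizable)
    (hHdg : ∀ ⦃n : ℕ⦄ ⦃X : Motives.SchemeOver ℂ⦄ (hX : IsSmoothProjective n X) (p : ℕ)
      (x : singularCohomology ℚ ℚ (ComplexPoints X) (2 * p)),
      x ∈ (H hX (2 * p)).hodgeClasses p ↔
        IsOfHodgeType n X (2 * p) p p
          (singularCohomology.ringChange (algebraMap ℚ ℂ) (ComplexPoints X) (2 * p) x))
    (hGys₀ : ∀ ⦃m n : ℕ⦄ ⦃Y X : Motives.SchemeOver ℂ⦄ (hY : IsSmoothProjective m Y)
        (hX : IsSmoothProjective n X) (f : Y ⟶ X) ⦃a b : ℕ⦄ (hab : a + 2 * n = b + 2 * m),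
        ∃ (u : ℂ) (ψ : singularCohomology ℚ ℚ (ComplexPoints Y) a →ₗ[ℚ]
            singularCohomology ℚ ℚ (ComplexPoints X) b),
          u ≠ 0 ∧ (∀ p : ℤ, ((H hY a).F p).map (ψ.baseChange ℂ) ≤ (H hX b).F (p + ((n : ℤ) - m))) ∧
            ∀ y, complexGysin μ₀ hY hX f hab
                (singularCohomology.ringChange (algebraMap ℚ ℂ) (ComplexPoints Y) a y) =
              u • singularCohomology.ringChange (algebraMap ℚ ℂ) (ComplexPoints X) b (ψ y)) :
    Voisin2025_hodgeClass_lift_complexGysin :=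
  Voisin2025_hodgeClass_lift_complexGysin_of_orientationFamily μ₀ hμ₀
    fun _ _ hX _ _ _ _ hY g q _ hc hc' hcg ↦
      Voisin2025_hodgeClass_lift_complexGysin.of_hodgeStructures μ₀ hX hY g q (H hX (2 * q))
        (fun j d _ ↦ H (hY j) (2 * d)) (fun j d _ ↦ hpol (hY j) (2 * d))
        (fun x hx ↦ (hHdg hX q x).2 hx) (fun j d _ y hy ↦ (hHdg (hY j) d y).1 hy)
        (fun j _ hd ↦ hGys₀ (hY j) hX (g j) hd) hc hc' hcg

/-! ### The Gysin hypothesis reduced to the bidegree of the rational Gysin homomorphisms -/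

/-- **`Voisin2025_hodgeClass_lift_complexGysin` from polarised Hodge structures on the rational
cohomology of smooth projective varieties and the bidegree of the RATIONAL Gysin homomorphisms.**
Let `H` assign to every smooth projective `X` of dimension `n` and every `k` a Hodge structure of
weight `k` on `Hᵏ(X(ℂ); ℚ)`, polarisable (`hpol`), whose Hodge classes are the rational classes
of type `(p, p)` (`hHdg`); and suppose (`hbideg`) that for every morphism `f : Y ⟶ X` of smooth
projective varieties and all `a + q = 2 dim Y`, `b + q = 2 dim X` there are `ℚ`-orientations
`ν_Y`, `ν_X` of `Y(ℂ)`, `X(ℂ)`, with Poincaré duality for `ν_X`, for which the rational Gysin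
homomorphism `gysinMap ν_Y ν_X f(ℂ) : Hᵃ(Y(ℂ); ℚ) → Hᵇ(X(ℂ); ℚ)` (`PD⁻¹ ∘ f(ℂ)_* ∘ PD`, Fulton
App. B (5)) has bidegree `(dim X − dim Y, dim X − dim Y)` for the Hodge filtrations — Voisin I,
§7.3.2: "the Gysin morphism `φ_* : Hᵏ(X, ℤ) → H^{k+2r}(Y, ℤ)` is defined using Poincaré duality
[…] `φ_*` is a morphism of Hodge structures of bidegree `(r, r)`". THEN the named fact holds, for
every `ℂ`-orientation family `μ` with Poincaré duality: `complexGysin μ` is `u • ι ∘ gysinMap ∘ ι⁻¹`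
on rational classes, `u ≠ 0` (`complexGysin_ringChange_eq_smul_gysinMap`), so
`Voisin2025_hodgeClass_lift_complexGysin.of_hodgeStructures` applies (in degrees `a > 2 dim Y`,
where `complexGysin = 0`, with `ψ = 0`). (`ℚ`-orientations with Poincaré duality exist:
`Motives.ComplexPoints.isOrientableOver`, `….bijective_poincareDualityMap_of_isSmoothProjective`.)
[cite: Voisin2025, Cor. 2.12, Prop. 2.11, §2.1 and proof of Prop. 3.8]
[cite: VoisinHodgeI2002, §7.1.1, §7.1.2, Lemma 7.26 and §7.3.2] [cite: Deligne2000, §1]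
[cite: FultonYoungTableaux1997, Appendix B §B.1 (5)] -/
theorem Voisin2025_hodgeClass_lift_complexGysin_of_hodgeStructures_of_rationalGysin
    (H : ∀ ⦃n : ℕ⦄ ⦃X : Motives.SchemeOver ℂ⦄, IsSmoothProjective n X → ∀ k : ℕ,
      HodgeStructure (singularCohomology ℚ ℚ (ComplexPoints X) k) (k : ℤ))
    (hpol : ∀ ⦃n : ℕ⦄ ⦃X : Motives.SchemeOver ℂ⦄ (hX : IsSmoothProjective n X) (k : ℕ),
      (H hX k).IsPolarizable)
    (hHdg : ∀ ⦃n : ℕ⦄ ⦃X : Motives.SchemeOver ℂ⦄ (hX : IsSmoothProjective n X) (p : ℕ)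
      (x : singularCohomology ℚ ℚ (ComplexPoints X) (2 * p)),
      x ∈ (H hX (2 * p)).hodgeClasses p ↔
        IsOfHodgeType n X (2 * p) p p
          (singularCohomology.ringChange (algebraMap ℚ ℂ) (ComplexPoints X) (2 * p) x))
    (hbideg : ∀ ⦃m n : ℕ⦄ ⦃Y X : Motives.SchemeOver ℂ⦄ (hY : IsSmoothProjective m Y)
        (hX : IsSmoothProjective n X) (f : Y ⟶ X) ⦃a b q : ℕ⦄ (ha : a + q = 2 * m)
        (hb : b + q = 2 * n),
        ∃ (νY : HomologicalOrientation ℚ (ComplexPoints Y) (2 * m))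
          (νX : HomologicalOrientation ℚ (ComplexPoints X) (2 * n)), νX.HasPoincareDuality ∧
          ∀ p : ℤ, ((H hY a).F p).map
              ((gysinMap νY νX (AlgPoints.mapContinuous (L := ℂ) f) ha hb).baseChange ℂ) ≤
            (H hX b).F (p + ((n : ℤ) - m))) :
    Voisin2025_hodgeClass_lift_complexGysin := by
  intro μ hμ n X hX ι _ m Y hY g q c hc hc' hcg
  refine Voisin2025_hodgeClass_lift_complexGysin.of_hodgeStructures μ hX hY g q (H hX (2 * q))
    (fun j d _ ↦ H (hY j) (2 * d)) (fun j d _ ↦ hpol (hY j) (2 * d))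
    (fun x hx ↦ (hHdg hX q x).2 hx) (fun j d _ y hy ↦ (hHdg (hY j) d y).1 hy)
    (fun j d hd ↦ ?_) hc hc' hcg
  by_cases hle : 2 * d ≤ 2 * m j
  · obtain ⟨νY, νX, hνX, hF⟩ := hbideg (hY j) hX (g j) (a := 2 * d) (b := 2 * q)
      (q := 2 * m j - 2 * d) (by omega) (by omega)
    obtain ⟨u, hu, hcomp⟩ := complexGysin_ringChange_eq_smul_gysinMap hμ (hY j) hX (g j)
      (show 2 * d + (2 * m j - 2 * d) = 2 * m j by omega)
      (show 2 * q + (2 * m j - 2 * d) = 2 * n by omega) νY νX hνX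
    exact ⟨u, _, hu, hF, hcomp⟩
  · refine ⟨1, 0, one_ne_zero, fun p ↦ ?_, fun y ↦ ?_⟩
    · rw [LinearMap.baseChange_zero, Submodule.map_zero]
      exact bot_le
    · rw [complexGysin_of_lt (hY j) hX (g j) hd (by omega), LinearMap.zero_apply,
        LinearMap.zero_apply, map_zero, smul_zero]

end Reduction

/-! ### The inputs from Hodge models: the named fact from de Rham's theorem, the Hodge
decomposition and the polarisations -/

section HodgeModels

open scoped Manifold ContDiff
open Literature.AlgebraicGeometry.Motives
open Literature.NumberTheory.Transcendental (exists_deRhamIsoFamily)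

variable {m n : ℕ} {Y X : Motives.SchemeOver ℂ}

/-- **No Hodge types beyond the dimension**: for `X` smooth projective of dimension `n` with a
Hodge model `A` on which cup products add Hodge types (`CupPreservesHodgeType`), a class
`x ∈ Hᵈ(X(ℂ); ℂ)` whose pull-back to `A` lies in `H^{r,s}` with `r > n` or `s > n` is zero: it
pairs to zero with every pure-type class `b` of the complementary degree (`x ∪ b` is of type
`(r + r', s + s') ≠ (n, n)` in degree `2n`, `cupProduct_eq_zero_of_hodgeType`), hence with every
class (Hodge decomposition of the model), hence vanishes (the Poincaré pairing of `X(ℂ)` is perfect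
over `ℂ`, `eq_zero_of_forall_cupPairing_eq_zero`). (Voisin I, §2.3.1:
`Ω^{p,q} = Λᵖ Ω^{1,0} ⊗ Λ^q Ω^{0,1}` vanishes for `p > n` or `q > n`; read cohomologically.)
[cite: VoisinHodgeI2002, §2.3.1, Cor. 6.14 and Lemma 7.30 (proof)] [cite: HatcherAT2002, §3.3 Prop. 3.38] -/
theorem HodgeModel.eq_zero_of_mem_hodgePQ_of_lt (hI : hodgePQ_independent_of_hodgeModel)
    (μ : OrientationFamily) (hX : IsSmoothProjective n X) (A : HodgeModel n X)
    (hcup : CupPreservesHodgeType n X) {d r s : ℕ} (hrs : n < r ∨ n < s) {x : complexBetti X d}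
    (hx : A.pullback d x ∈ A.hodgePQ d r s) : x = 0 := by
  by_cases hd : d ≤ 2 * n
  · obtain ⟨d', hdd'⟩ : ∃ d', d + d' = 2 * n := ⟨2 * n - d, by omega⟩
    refine eq_zero_of_forall_cupPairing_eq_zero μ hX hdd' fun b ↦ ?_
    obtain ⟨w, hw, hwt⟩ := A.exists_sum_eq_of_hodgeDecomposition d' b
    rw [← hw, map_sum]
    refine Finset.sum_eq_zero fun j hj ↦ ?_
    rw [cupPairing_apply, cupProduct_eq_zero_of_hodgeType hI hX A hcup hdd' ?_ hx (hwt j hj),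
      map_zero, LinearMap.zero_apply]
    rintro ⟨h1, h2⟩
    omega
  · haveI := subsingleton_complexBetti hX (not_le.1 hd)
    exact Subsingleton.elim _ _

/-- **The Gysin morphism kills the Hodge types it cannot shift**: for `f : Y ⟶ X` of smooth
projective varieties of dimensions `m`, `n` with Hodge models `B`, `A` on which cup products add
Hodge types, and `y ∈ Hᵃ(Y(ℂ); ℂ)` of type `(p, q)` (read in `B`) with `p + n < m` or `q + n < m`
(so that the shifted type `(p + n - m, q + n - m)` does not exist), `f_* y = 0`. Printed argument
(Voisin I, §7.3.2 with Lemma 7.30): `(f_* y, x)_X = (y, f^* x)_Y` for `x` of pure type `(r, s)`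
(`cupPairing_gysinMap`); `y ∪ f^* x`, of type `(p + r, q + s)` in degree `2m`, vanishes unless
`(p + r, q + s) = (m, m)` (`HodgeModel.eq_zero_of_mem_hodgePQ_two_mul`), and in that case
`s = m - q > n` (or `r > n`), so `x = 0` (`HodgeModel.eq_zero_of_mem_hodgePQ_of_lt`); the pairing
on `X(ℂ)` being perfect, `f_* y = 0`. [cite: VoisinHodgeI2002, §7.3.2 (with Lemma 7.30)]
[cite: HatcherAT2002, §3.3 Prop. 3.38] -/
theorem complexGysin_eq_zero_of_hodgeType_of_lt (hI : hodgePQ_independent_of_hodgeModel)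
    (μ : OrientationFamily) (hY : IsSmoothProjective m Y) (hX : IsSmoothProjective n X)
    (B : HodgeModel m Y) (A : HodgeModel n X) (hcY : CupPreservesHodgeType m Y)
    (hcX : CupPreservesHodgeType n X) (f : Y ⟶ X) {a b : ℕ} (hab : a + 2 * n = b + 2 * m)
    {p q : ℕ} (hpq : p + n < m ∨ q + n < m) {y : complexBetti Y a}
    (hy : B.pullback a y ∈ B.hodgePQ a p q) : complexGysin μ hY hX f hab y = 0 := by
  by_cases hdeg : a ≤ 2 * m
  · obtain ⟨d, ha⟩ : ∃ d, a + d = 2 * m := ⟨2 * m - a, by omega⟩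
    have hb : b + d = 2 * n := by omega
    rw [complexGysin_eq_gysinMap hY hX f hab ha hb]
    refine eq_zero_of_forall_cupPairing_eq_zero μ hX hb fun x ↦ ?_
    obtain ⟨w, hw, hwt⟩ := A.exists_sum_eq_of_hodgeDecomposition d x
    rw [← hw, map_sum]
    refine Finset.sum_eq_zero fun j hj ↦ ?_
    rw [cupPairing_gysinMap (μ.hasPoincareDuality hX) _ ha hb y (w j), cupPairing_apply]
    by_cases hj' : p + j.1 = m ∧ q + j.2 = m
    · -- the complementary type lies beyond the dimension of `X`: `w j = 0`
      have hw0 : w j = 0 :=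
        A.eq_zero_of_mem_hodgePQ_of_lt hI μ hX hcX (d := d) (r := j.1) (s := j.2) (by omega)
          (hwt j hj)
      rw [hw0, map_zero, map_zero, map_zero, LinearMap.zero_apply]
    · -- `y ∪ f^* (w j)` is of type `(p + j.1, q + j.2) ≠ (m, m)` in degree `2m`
      have hfx : IsOfHodgeType m Y d j.1 j.2 (complexBetti.map f d (w j)) :=
        IsOfHodgeType.map_of_independent hI ⟨A, hwt j hj⟩ hY hX B f
      have hcupT : IsOfHodgeType m Y (2 * m) (p + j.1) (q + j.2)
          (cupProduct ha y (complexBetti.map f d (w j))) :=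
        hcY ha ⟨B, hy⟩ hfx
      have hne : (p + j.1, q + j.2) ≠ (m, m) := by
        intro heq
        exact hj' ⟨congrArg Prod.fst heq, congrArg Prod.snd heq⟩
      rw [B.eq_zero_of_mem_hodgePQ_two_mul hne ((hI.isOfHodgeType_iff hY B).1 hcupT), map_zero,
        LinearMap.zero_apply]
  · rw [complexGysin_of_lt hY hX f hab (not_le.1 hdeg), LinearMap.zero_apply]

/-- A `ℂ`-linear `G` which is `u • ψ` on rational classes (`G (ι y) = u • ι (ψ y)`,
`ι = singularCohomology.ringChange (ℚ ↪ ℂ)`) is `u • (ψ ⊗ ℂ)` through the complexifications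
`β = ofRatClassBaseChange`: `G (β t) = u • β ((ψ ⊗ ℂ) t)` (`ofRatClass = ι`,
`ofRatClass_eq_ringChange`). [cite: HatcherAT2002, §3.1 p. 198] -/
theorem apply_ofRatClassBaseChange_eq_smul {a b : ℕ} (G : complexBetti Y a →ₗ[ℂ] complexBetti X b)
    (ψ : singularCohomology ℚ ℚ (ComplexPoints Y) a →ₗ[ℚ] singularCohomology ℚ ℚ (ComplexPoints X) b)
    (u : ℂ)
    (h : ∀ y, G (singularCohomology.ringChange (algebraMap ℚ ℂ) (ComplexPoints Y) a y) =
      u • singularCohomology.ringChange (algebraMap ℚ ℂ) (ComplexPoints X) b (ψ y))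
    (t : ℂ ⊗[ℚ] singularCohomology ℚ ℚ (ComplexPoints Y) a) :
    G (ofRatClassBaseChange (ComplexPoints Y) a t) =
      u • ofRatClassBaseChange (ComplexPoints X) b (ψ.baseChange ℂ t) := by
  induction t using TensorProduct.induction_on with
  | zero => simp only [map_zero, smul_zero]
  | tmul c y =>
    rw [LinearMap.baseChange_tmul, ofRatClassBaseChange_tmul, ofRatClassBaseChange_tmul, map_smul,
      ofRatClass_eq_ringChange, ofRatClass_eq_ringChange, h, smul_comm]
  | add x y hx hy => rw [map_add, map_add, hx, hy, map_add, map_add, smul_add]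

/-- **The Gysin morphism has bidegree `(n - m, n - m)` for the Hodge filtrations of the Hodge
structures of Hodge models** (Voisin I, §7.3.2: "`φ_*` is a morphism of Hodge structures of
bidegree `(r, r)`"; Voisin 2025, §2.1: "up to a shift of bidegrees by `(n, n)` that is called a
Tate twist"). Let `f : Y ⟶ X` be a morphism of smooth projective varieties of dimensions `m`, `n`
with Hodge symmetric Hodge models `B`, `A` on which cup products add Hodge types, `μ` an
orientation family, `a + 2n = b + 2m`, and `ψ : Hᵃ(Y(ℂ); ℚ) → Hᵇ(X(ℂ); ℚ)` a `ℚ`-linear map with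
`f_* (ι y) = u • ι (ψ y)` for a scalar `u ≠ 0` (the rational Gysin morphism up to the orientation
scalar). Then `(ψ ⊗ ℂ)(Fʳ) ⊆ F^{r + n - m}` for the filtrations `Fʳ = Θ⁻¹(⨁_{p ≥ r} H^{p,k-p})` of
`B.hodgeStructure`, `A.hodgeStructure`: on a piece `Θ_B⁻¹(H^{p,q})`, `p ≥ r`, either the shifted
type exists and `f_*` lands in `Θ_A⁻¹(H^{p+n-m,q+n-m}) ⊆ F^{r+n-m}`
(`isOfHodgeType_complexGysin_of_cupPreservesHodgeType`), or `f_*` vanishes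
(`complexGysin_eq_zero_of_hodgeType_of_lt`). [cite: VoisinHodgeI2002, §7.3.2 (with Lemma 7.30)]
[cite: VoisinHodgeI2002, §7.1.1 Def. 7.4] [cite: Voisin2025, §2.1] -/
theorem HodgeModel.map_baseChange_hodgeStructure_F_le (hI : hodgePQ_independent_of_hodgeModel)
    (μ : OrientationFamily) (hY : IsSmoothProjective m Y) (hX : IsSmoothProjective n X)
    (B : HodgeModel m Y) (A : HodgeModel n X) (hB : B.IsHodgeSymmetric) (hA : A.IsHodgeSymmetric)
    (hcY : CupPreservesHodgeType m Y) (hcX : CupPreservesHodgeType n X) (f : Y ⟶ X) {a b : ℕ}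
    (hab : a + 2 * n = b + 2 * m)
    (ψ : singularCohomology ℚ ℚ (ComplexPoints Y) a →ₗ[ℚ] singularCohomology ℚ ℚ (ComplexPoints X) b)
    {u : ℂ} (hu : u ≠ 0)
    (hψ : ∀ y, complexGysin μ hY hX f hab
        (singularCohomology.ringChange (algebraMap ℚ ℂ) (ComplexPoints Y) a y) =
      u • singularCohomology.ringChange (algebraMap ℚ ℂ) (ComplexPoints X) b (ψ y)) (r : ℤ) :
    ((B.hodgeStructure hY hB a).F r).map (ψ.baseChange ℂ) ≤
      (A.hodgeStructure hX hA b).F (r + ((n : ℤ) - m)) := by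
  rintro _ ⟨t, ht, rfl⟩
  rw [SetLike.mem_coe, HodgeModel.hodgeStructure_F, HodgeModel.ratF_eq_iSup] at ht
  rw [HodgeModel.hodgeStructure_F, HodgeModel.ratF_eq_iSup]
  induction ht using Submodule.iSup_induction' with
  | mem pq t ht =>
    by_cases hr : r ≤ (pq.1.1 : ℤ)
    · rw [iSup_pos hr, HodgeModel.mem_ratPiece_iff, HodgeModel.complexification_apply] at ht
      have hpq : pq.1.1 + pq.1.2 = a := Finset.HasAntidiagonal.mem_antidiagonal.1 pq.2
      -- `f_* (β t) = u • β ((ψ ⊗ ℂ) t)`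
      have key := apply_ofRatClassBaseChange_eq_smul (complexGysin μ hY hX f hab) ψ u hψ t
      by_cases hlt : pq.1.1 + n < m ∨ pq.1.2 + n < m
      · -- the shifted type does not exist: `f_* (β t) = 0`, so `(ψ ⊗ ℂ) t = 0`
        have h0 : complexGysin μ hY hX f hab (ofRatClassBaseChange (ComplexPoints Y) a t) = 0 :=
          complexGysin_eq_zero_of_hodgeType_of_lt hI μ hY hX B A hcY hcX f hab hlt ht
        rw [h0, eq_comm, smul_eq_zero, or_iff_right hu] at key
        have ht0 : ψ.baseChange ℂ t = 0 :=
          ofRatClassBaseChange_injective _ b (by rw [key, map_zero])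
        rw [ht0]
        exact Submodule.zero_mem _
      · -- the shifted type `(p', q')`, `p' + m = p + n`, `q' + m = q + n`
        push Not at hlt
        obtain ⟨p', hp'⟩ : ∃ p', p' + m = pq.1.1 + n := ⟨pq.1.1 + n - m, by omega⟩
        obtain ⟨q', hq'⟩ : ∃ q', q' + m = pq.1.2 + n := ⟨pq.1.2 + n - m, by omega⟩
        have htyp : IsOfHodgeType n X b p' q'
            (complexGysin μ hY hX f hab (ofRatClassBaseChange (ComplexPoints Y) a t)) :=
          isOfHodgeType_complexGysin_of_cupPreservesHodgeType hI μ hY hX B A hcY hcX f hab hp' hq'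
            ⟨B, ht⟩
        rw [key, hI.isOfHodgeType_iff hX A, map_smul] at htyp
        have hmem : A.pullback b (ofRatClassBaseChange (ComplexPoints X) b (ψ.baseChange ℂ t)) ∈
            A.hodgePQ b p' q' := (Submodule.smul_mem_iff _ hu).1 htyp
        have hanti : (p', q') ∈ Finset.HasAntidiagonal.antidiagonal b :=
          Finset.HasAntidiagonal.mem_antidiagonal.2 (by omega)
        refine Submodule.mem_iSup_of_mem ⟨(p', q'), hanti⟩ (Submodule.mem_iSup_of_mem ?_ ?_)
        · change r + ((n : ℤ) - m) ≤ (p' : ℤ)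
          omega
        · rw [HodgeModel.mem_ratPiece_iff, HodgeModel.complexification_apply]
          exact hmem
    · rw [iSup_neg hr, Submodule.mem_bot] at ht
      rw [ht, map_zero]
      exact Submodule.zero_mem _
  | zero => rw [map_zero]; exact Submodule.zero_mem _
  | add x y _ _ hx hy => rw [map_add]; exact Submodule.add_mem _ hx hy

/-- **`ℚ`-orientations of `X(ℂ)` with Poincaré duality exist** for `X` smooth projective of
dimension `n`: `X(ℂ)` is `R`-orientable for every ring (`Motives.ComplexPoints.isOrientableOver`)
and every orientation of the closed manifold `X(ℂ)` has Poincaré duality (the tree's theorem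
`poincare_duality`, Hatcher Thm. 3.30). [cite: HatcherAT2002, §3.3 p. 235 and Thm. 3.30] -/
theorem exists_ratOrientation_hasPoincareDuality (hX : IsSmoothProjective n X) :
    ∃ ν : HomologicalOrientation ℚ (ComplexPoints X) (2 * n), ν.HasPoincareDuality := by
  obtain ⟨ν⟩ := Motives.ComplexPoints.isOrientableOver ℚ hX
  letI := hX.chartedSpace
  haveI := Motives.ComplexPoints.compactSpace_of_isSmoothProjective hX
  haveI := Motives.ComplexPoints.t2Space_of_isSmoothProjective hX
  exact ⟨ν, HomologicalOrientation.HasPoincareDuality.of_bijective_poincareDualityMap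
    fun p q h ↦ poincare_duality ν h⟩

/-- **`Voisin2025_hodgeClass_lift_complexGysin` from real Hodge models, the independence of the
model, de Rham's theorem and the polarisations.** Granted the named facts
`exists_isReal_hodgeModel` (every smooth projective `X/ℂ` has a real Hodge model — Serre's
analytification with a real natural de Rham comparison and the Hodge decomposition; real models
are Hodge symmetric, `HodgeModel.IsReal.isHodgeSymmetric`), `hodgePQ_independent_of_hodgeModel`
(all models cut out the same `H^{p,q}`; a theorem, `hodgePQ_independent_of_hodgeModel_holds`) and
de Rham's theorem in multiplicative form `exists_deRhamIsoFamily` for the finite-dimensional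
complex model spaces (through which cup products add Hodge types,
`cupPreservesHodgeType_of_nonempty_hodgeModel`), and granted the polarisability `hpol` of the Hodge
structures `HodgeModel.hodgeStructure` of Hodge symmetric models (hard Lefschetz, Lefschetz
decomposition and Hodge–Riemann relations, Voisin I Thm. 6.32 and §7.1.2: "`H′ polarized`"), the
named fact holds: `Voisin2025_hodgeClass_lift_complexGysin_of_hodgeStructures` with `H` the Hodge
structures of chosen real models, `hHdg = HodgeModel.mem_hodgeClasses_iff_isOfHodgeType_ringChange`,
and the Gysin hypothesis supplied by `complexGysin_ringChange_eq_smul_gysinMap` (`f_*` is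
`u • (rational Gysin) ⊗ ℂ` on rational classes, `u ≠ 0`, for `ℚ`-orientations with Poincaré
duality, `exists_ratOrientation_hasPoincareDuality`) and
`HodgeModel.map_baseChange_hodgeStructure_F_le` (bidegree `(n - m, n - m)` for the filtrations);
in degrees `a > 2 dim Y`, `f_* = 0` and `ψ = 0`.
[cite: Voisin2025, Cor. 2.12, Prop. 2.11, §2.1 and proof of Prop. 3.8]
[cite: VoisinHodgeI2002, §6.1.3, Cor. 6.12, §7.1.1, §7.1.2, Lemma 7.30 and §7.3.2]
[cite: Deligne2000, §1] [cite: FultonYoungTableaux1997, Appendix B §B.1 (5)] -/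
theorem Voisin2025_hodgeClass_lift_complexGysin_of_exists_isReal_hodgeModel
    (hR : exists_isReal_hodgeModel) (hI : hodgePQ_independent_of_hodgeModel)
    (hdR : ∀ (E : Type) [NormedAddCommGroup E] [NormedSpace ℂ E] [FiniteDimensional ℂ E],
      exists_deRhamIsoFamily 𝓘(ℝ, E))
    (hpol : ∀ ⦃m : ℕ⦄ ⦃Y : Motives.SchemeOver ℂ⦄ (hY : IsSmoothProjective m Y) (A : HodgeModel m Y)
      (hA : A.IsHodgeSymmetric) (k : ℕ), (A.hodgeStructure hY hA k).IsPolarizable) :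
    Voisin2025_hodgeClass_lift_complexGysin := by
  -- a real, hence Hodge symmetric, Hodge model of every smooth projective variety
  let M : ∀ ⦃n : ℕ⦄ ⦃X : Motives.SchemeOver ℂ⦄, IsSmoothProjective n X → HodgeModel n X :=
    fun n X hX ↦ Classical.choose (hR n X hX)
  have hM : ∀ ⦃n : ℕ⦄ ⦃X : Motives.SchemeOver ℂ⦄ (hX : IsSmoothProjective n X),
      (M hX).IsHodgeSymmetric :=
    fun n X hX ↦ (Classical.choose_spec (hR n X hX)).isHodgeSymmetric
  -- cup products add Hodge types (de Rham's theorem in multiplicative form)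
  have hcup : ∀ ⦃n : ℕ⦄ ⦃X : Motives.SchemeOver ℂ⦄, IsSmoothProjective n X →
      CupPreservesHodgeType n X :=
    fun n X hX ↦ cupPreservesHodgeType_of_nonempty_hodgeModel hI (hR.nonempty_hodgeModel n X) hdR hX
  refine Voisin2025_hodgeClass_lift_complexGysin_of_hodgeStructures
    (fun n X hX k ↦ (M hX).hodgeStructure hX (hM hX) k) (fun n X hX k ↦ hpol hX (M hX) (hM hX) k)
    (fun n X hX p x ↦ (M hX).mem_hodgeClasses_iff_isOfHodgeType_ringChange hX hI (hM hX) p x)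
    fun μ hμ m n Y X hY hX f a b hab ↦ ?_
  by_cases hle : a ≤ 2 * m
  · -- `f_* (ι y) = u • ι (gysinMap ν_Y ν_X f(ℂ) y)` for rational orientations, `u ≠ 0`
    obtain ⟨νY⟩ := Motives.ComplexPoints.isOrientableOver ℚ hY
    obtain ⟨νX, hνX⟩ := exists_ratOrientation_hasPoincareDuality hX
    obtain ⟨u, hu, hcomp⟩ := complexGysin_ringChange_eq_smul_gysinMap hμ hY hX f
      (show a + (2 * m - a) = 2 * m by omega) (show b + (2 * m - a) = 2 * n by omega) νY νX hνX
    exact ⟨u, _, hu, (M hY).map_baseChange_hodgeStructure_F_le hI μ hY hX (M hX) (hM hY) (hM hX)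
      (hcup hY) (hcup hX) f hab _ hu hcomp, hcomp⟩
  · -- degrees `a > 2 dim Y`: `f_* = 0`
    refine ⟨1, 0, one_ne_zero, fun p ↦ ?_, fun y ↦ ?_⟩
    · rw [LinearMap.baseChange_zero, Submodule.map_zero]
      exact bot_le
    · rw [complexGysin_of_lt hY hX f hab (by omega), LinearMap.zero_apply, LinearMap.zero_apply,
        map_zero, smul_zero]

/-- **`Voisin2025_hodgeClass_lift_complexGysin` from de Rham's theorem, the Hodge decomposition
and the polarisations.** The trust base of the named fact on the tree's carriers, after this file:
(3ᵣ) de Rham's theorem `exists_deRhamIsoFamily 𝓘(ℝ, E)` (a natural, multiplicative, normalised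
family `H^k_dR(M; ℝ) ≅ Hᵏ(M; ℝ)`; de Rham 1931, Warner Thm. 5.36/5.45) for the finite-dimensional
complex model spaces; (4b) the Hodge decomposition of compact Kähler manifolds
`Motives.isInternal_hodgePQ` (Voisin I Prop. 6.11, Thm. 6.18) — these two give real Hodge models
(`exists_isReal_hodgeModel_of_deRham_of_hodgeDecomposition`: Serre's analytification is compact,
Hausdorff and Kähler), while the independence of the model is the theorem
`hodgePQ_independent_of_hodgeModel_holds`; and `hpol`, the polarisability of the resulting Hodge
structures on `Hᵏ(Y(ℂ); ℚ)` (Voisin I Thm. 6.32; the printed "`H′ polarized`").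
[cite: Voisin2025, Cor. 2.12, Prop. 2.11, §2.1 and proof of Prop. 3.8]
[cite: VoisinHodgeI2002, Prop. 6.11, Cor. 6.12, Thm. 6.32, §7.1.1, Lemma 7.30 and §7.3.2]
[cite: SerreGAGA1956, §2] [cite: Deligne2000, §1] -/
theorem Voisin2025_hodgeClass_lift_complexGysin_of_deRham_of_hodgeDecomposition
    (h3 : ∀ (E : Type) [NormedAddCommGroup E] [NormedSpace ℂ E] [FiniteDimensional ℂ E],
      exists_deRhamIsoFamily 𝓘(ℝ, E))
    (h4b : ∀ (E : Type) [NormedAddCommGroup E] [NormedSpace ℂ E] [FiniteDimensional ℂ E]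
      (M : Type) [TopologicalSpace M] [ChartedSpace E M] [IsManifold 𝓘(ℝ, E) ∞ M],
      Motives.isInternal_hodgePQ (E := E) (M := M))
    (hpol : ∀ ⦃m : ℕ⦄ ⦃Y : Motives.SchemeOver ℂ⦄ (hY : IsSmoothProjective m Y) (A : HodgeModel m Y)
      (hA : A.IsHodgeSymmetric) (k : ℕ), (A.hodgeStructure hY hA k).IsPolarizable) :
    Voisin2025_hodgeClass_lift_complexGysin :=
  Voisin2025_hodgeClass_lift_complexGysin_of_exists_isReal_hodgeModel
    (exists_isReal_hodgeModel_of_deRham_of_hodgeDecomposition h3 h4b)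
    hodgePQ_independent_of_hodgeModel_holds h3 hpol

end HodgeModels

end HodgeTheory

end Literature.AlgebraicGeometry.HodgeTheory

end
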